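import Summits.SmoothPoincare4.SmoothPoincare4.Theorems.RootDecompAEDoublesShadowTwoRoeTableA
import Summits.SmoothPoincare4.SmoothPoincare4.Theorems.RootDecompAEDoublesShadowTwoRoeTableB
import Summits.SmoothPoincare4.SmoothPoincare4.Theorems.RootDecompAEDoublesShadowTwoRoeTableC
import Summits.SmoothPoincare4.SmoothPoincare4.Theorems.RootDecompAEDoublesShadowTwoRoeTableD
import Summits.SmoothPoincare4.SmoothPoincare4.Theorems.RootDecompAEDoublesShadowTwoRoeTableE
import Summits.SmoothPoincare4.SmoothPoincare4.Theorems.RootDecompAEDoublesShadowTwoRoeTableF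
import Summits.SmoothPoincare4.SmoothPoincare4.Theorems.RootDecompAEDoublesShadowTwoRoeGluing

/-!
# Grade-two dichotomy for KMN encoding graphs (Roe certificates), part 12/17: the local table dispatch; the local step

§4c `localTable`: dispatch of the local table over the piece type; §8 THE LOCAL STEP `localCert_of_um`: local
unimodularity of the block (rows at `u`) × (used letters of `u`) gives the hypotheses of the local table, hence a
local certificate on exactly the used ports.

THE FAMILY (16 modules `Theorems/RootDecompAEDoublesShadowTwoRoe*.lean` + the closing module
`Theorems/RootDecompAEDoublesShadowTwoStubGradeTwoDichotomy.lean`, one namespace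
`Summit.SmoothPoincare4.SmoothPoincare4.Theorems.RootDecompAEDoublesShadowTwoStubGradeTwoDichotomy`, chained imports,
split by topic to respect the 400-line bound on proof files; the local-table parts import only `…RoeDefs`).
-/

open Function
open Literature.Topology.FourManifolds

set_option linter.dupNamespace false

noncomputable section

namespace Summit.SmoothPoincare4.SmoothPoincare4.Theorems.RootDecompAEDoublesShadowTwoStubGradeTwoDichotomy

/-! ### Dispatch over the piece type -/

/-- **THE LOCAL TABLE (★).**  For every piece and every strictly increasing list of `rank` existing ports whose local
minor is `±1`, the piece admits a local elimination certificate on exactly these ports (dispatch over the six basic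
pieces, the eleven figure-eight blocks, the 57 melon blocks and the 116 handcuff blocks). -/
theorem localTable (p : Piece) {J : List ℕ} (h : TableHyp p J) : LocalCert p J := by
  cases p with
  | disc => exact localTable_disc h
  | pants => exact localTable_pants h
  | moebius => exact localTable_moebius h
  | y111 => exact localTable_y111 h
  | y12 => exact localTable_y12 h
  | y3 => exact localTable_y3 h
  | x8 i =>
    fin_cases i
    exacts [localTable_x8_0 h, localTable_x8_1 h, localTable_x8_2 h, localTable_x8_3 h, localTable_x8_4 h, localTable_x8_5 h, localTable_x8_6 h, localTable_x8_7 h, localTable_x8_8 h, localTable_x8_9 h, localTable_x8_10 h]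
  | melon i =>
    fin_cases i
    exacts [localTable_melon_0 h, localTable_melon_1 h, localTable_melon_2 h, localTable_melon_3 h,
      localTable_melon_4 h, localTable_melon_5 h, localTable_melon_6 h, localTable_melon_7 h, localTable_melon_8 h,
      localTable_melon_9 h, localTable_melon_10 h, localTable_melon_11 h, localTable_melon_12 h,
      localTable_melon_13 h, localTable_melon_14 h, localTable_melon_15 h, localTable_melon_16 h,
      localTable_melon_17 h, localTable_melon_18 h, localTable_melon_19 h, localTable_melon_20 h,
      localTable_melon_21 h, localTable_melon_22 h, localTable_melon_23 h, localTable_melon_24 h,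
      localTable_melon_25 h, localTable_melon_26 h, localTable_melon_27 h, localTable_melon_28 h,
      localTable_melon_29 h, localTable_melon_30 h, localTable_melon_31 h, localTable_melon_32 h,
      localTable_melon_33 h, localTable_melon_34 h, localTable_melon_35 h, localTable_melon_36 h,
      localTable_melon_37 h, localTable_melon_38 h, localTable_melon_39 h, localTable_melon_40 h,
      localTable_melon_41 h, localTable_melon_42 h, localTable_melon_43 h, localTable_melon_44 h,
      localTable_melon_45 h, localTable_melon_46 h, localTable_melon_47 h, localTable_melon_48 h,
      localTable_melon_49 h, localTable_melon_50 h, localTable_melon_51 h, localTable_melon_52 h,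
      localTable_melon_53 h, localTable_melon_54 h, localTable_melon_55 h, localTable_melon_56 h]
  | handcuff i =>
    fin_cases i
    exacts [localTable_handcuff_0 h, localTable_handcuff_1 h, localTable_handcuff_2 h, localTable_handcuff_3 h,
      localTable_handcuff_4 h, localTable_handcuff_5 h, localTable_handcuff_6 h, localTable_handcuff_7 h,
      localTable_handcuff_8 h, localTable_handcuff_9 h, localTable_handcuff_10 h, localTable_handcuff_11 h,
      localTable_handcuff_12 h, localTable_handcuff_13 h, localTable_handcuff_14 h, localTable_handcuff_15 h,
      localTable_handcuff_16 h, localTable_handcuff_17 h, localTable_handcuff_18 h, localTable_handcuff_19 h,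
      localTable_handcuff_20 h, localTable_handcuff_21 h, localTable_handcuff_22 h, localTable_handcuff_23 h,
      localTable_handcuff_24 h, localTable_handcuff_25 h, localTable_handcuff_26 h, localTable_handcuff_27 h,
      localTable_handcuff_28 h, localTable_handcuff_29 h, localTable_handcuff_30 h, localTable_handcuff_31 h,
      localTable_handcuff_32 h, localTable_handcuff_33 h, localTable_handcuff_34 h, localTable_handcuff_35 h,
      localTable_handcuff_36 h, localTable_handcuff_37 h, localTable_handcuff_38 h, localTable_handcuff_39 h,
      localTable_handcuff_40 h, localTable_handcuff_41 h, localTable_handcuff_42 h, localTable_handcuff_43 h,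
      localTable_handcuff_44 h, localTable_handcuff_45 h, localTable_handcuff_46 h, localTable_handcuff_47 h,
      localTable_handcuff_48 h, localTable_handcuff_49 h, localTable_handcuff_50 h, localTable_handcuff_51 h,
      localTable_handcuff_52 h, localTable_handcuff_53 h, localTable_handcuff_54 h, localTable_handcuff_55 h,
      localTable_handcuff_56 h, localTable_handcuff_57 h, localTable_handcuff_58 h, localTable_handcuff_59 h,
      localTable_handcuff_60 h, localTable_handcuff_61 h, localTable_handcuff_62 h, localTable_handcuff_63 h,
      localTable_handcuff_64 h, localTable_handcuff_65 h, localTable_handcuff_66 h, localTable_handcuff_67 h,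
      localTable_handcuff_68 h, localTable_handcuff_69 h, localTable_handcuff_70 h, localTable_handcuff_71 h,
      localTable_handcuff_72 h, localTable_handcuff_73 h, localTable_handcuff_74 h, localTable_handcuff_75 h,
      localTable_handcuff_76 h, localTable_handcuff_77 h, localTable_handcuff_78 h, localTable_handcuff_79 h,
      localTable_handcuff_80 h, localTable_handcuff_81 h, localTable_handcuff_82 h, localTable_handcuff_83 h,
      localTable_handcuff_84 h, localTable_handcuff_85 h, localTable_handcuff_86 h, localTable_handcuff_87 h,
      localTable_handcuff_88 h, localTable_handcuff_89 h, localTable_handcuff_90 h, localTable_handcuff_91 h,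
      localTable_handcuff_92 h, localTable_handcuff_93 h, localTable_handcuff_94 h, localTable_handcuff_95 h,
      localTable_handcuff_96 h, localTable_handcuff_97 h, localTable_handcuff_98 h, localTable_handcuff_99 h,
      localTable_handcuff_100 h, localTable_handcuff_101 h, localTable_handcuff_102 h, localTable_handcuff_103 h,
      localTable_handcuff_104 h, localTable_handcuff_105 h, localTable_handcuff_106 h, localTable_handcuff_107 h,
      localTable_handcuff_108 h, localTable_handcuff_109 h, localTable_handcuff_110 h, localTable_handcuff_111 h,
      localTable_handcuff_112 h, localTable_handcuff_113 h, localTable_handcuff_114 h, localTable_handcuff_115 h]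

/-! ## §8 The local step: local unimodularity at a piece gives the hypotheses of the local table -/

namespace ShadowGraph

variable (G₂ : ShadowGraph)

/-- The ports of `u` used by the rows `ru`, in increasing order. -/
def uports (ru : Finset (Fin G₂.m)) (u : Fin G₂.k) : List ℕ := (ru.image fun e => G₂.uport e u).sort (· ≤ ·)

variable {G₂}

/-- Membership in the port list of `ru` at `u`. -/
theorem mem_uports {ru : Finset (Fin G₂.m)} {u : Fin G₂.k} {j : ℕ} :
    j ∈ G₂.uports ru u ↔ ∃ e ∈ ru, G₂.uport e u = j := by
  simp [uports, Finset.mem_image]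

/-- The entries of the table at `u` in a row at `u`: signed exponents of the used port word. -/
theorem tab_u_pexp (hself : ∀ e, (G₂.src e).1 ≠ (G₂.tgt e).1) {e : Fin G₂.m} {u : Fin G₂.k}
    (ht : (G₂.src e).1 = u ∨ (G₂.tgt e).1 = u) (i : Fin 3) :
    G₂.tab e (Sum.inl (u, i)) = G₂.ucoef e u * pexp (G₂.piece u) (G₂.uport e u) i :=
  tab_u (hself e) ht i

/-- A `2`-vector with distinct entries is injective. -/
theorem injective_vec2 {α : Type} {a b : α} (h : a ≠ b) : Function.Injective ![a, b] := by
  intro i j hij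
  fin_cases i <;> fin_cases j
  · rfl
  · exact absurd (by simpa using hij) h
  · exact absurd (by simpa using hij.symm) h
  · rfl

/-- A `3`-vector with distinct entries is injective. -/
theorem injective_vec3 {α : Type} {a b c : α} (h₁ : a ≠ b) (h₂ : a ≠ c) (h₃ : b ≠ c) :
    Function.Injective ![a, b, c] := by
  intro i j hij
  fin_cases i <;> fin_cases j
  · rfl
  · exact absurd (by simpa using hij) h₁
  · exact absurd (by simpa using hij) h₂
  · exact absurd (by simpa using hij.symm) h₁
  · rfl
  · exact absurd (by simpa using hij) h₃
  · exact absurd (by simpa using hij.symm) h₂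
  · exact absurd (by simpa using hij.symm) h₃
  · rfl

/-- THE LOCAL MINOR IS A UNIT: if the block `ru × cols {u}` is unimodular and `J` lists the ports of `rank u` rows of
`ru` in increasing order, the local minor of `J` is `±1` (the row signs `ucoef = ±1` factor out of the determinant). -/
theorem minor_unit_of_um (hself : ∀ e, (G₂.src e).1 ≠ (G₂.tgt e).1) {u : Fin G₂.k} {ru : Finset (Fin G₂.m)}
    (hru : ∀ e ∈ ru, (G₂.src e).1 = u ∨ (G₂.tgt e).1 = u) (hum : UM G₂.tab ru (G₂.cols {u})) {J : List ℕ}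
    (hlen : J.length = (G₂.piece u).rank) (hpw : J.Pairwise (· < ·)) (hJ : ∀ j ∈ J, ∃ e ∈ ru, G₂.uport e u = j) :
    minor (G₂.piece u) J = 1 ∨ minor (G₂.piece u) J = -1 := by
  classical
  have hcard : ru.card = (G₂.piece u).rank := by rw [hum.card_eq, cols_singleton_card₂]
  have hmem : ∀ i : Fin 3, (i : ℕ) < (G₂.piece u).rank → (Sum.inl (u, i) : G₂.Gen) ∈ G₂.cols {u} := fun i hi =>
    (G₂.inl_mem_cols _ _ _).mpr ⟨Finset.mem_singleton_self u, hi⟩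
  have hr3 := rank_le_three (G₂.piece u)
  rcases (by omega : (G₂.piece u).rank = 0 ∨ (G₂.piece u).rank = 1 ∨ (G₂.piece u).rank = 2 ∨ (G₂.piece u).rank = 3)
    with h0 | h1 | h2 | h3
  · rw [h0] at hlen
    rw [List.eq_nil_of_length_eq_zero hlen]
    exact Or.inl rfl
  · rw [h1] at hlen hcard hmem
    match J, hlen, hJ with
    | [j₀], _, hJ =>
      obtain ⟨e₀, he₀, hp₀⟩ := hJ j₀ (by simp)
      have key := hum.isUnit_det_enum ![e₀] ![(Sum.inl (u, 0) : G₂.Gen)]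
        (fun i j _ => Subsingleton.elim i j) (fun i j _ => Subsingleton.elim i j)
        (fun i => by fin_cases i; exact he₀) (fun i => by fin_cases i; exact hmem 0 (by decide)) hcard
      rw [Matrix.det_fin_one] at key
      simp only [Matrix.of_apply, Matrix.cons_val_zero, tab_u_pexp hself (hru e₀ he₀), hp₀] at key
      have key' : IsUnit (G₂.ucoef e₀ u * minor (G₂.piece u) [j₀]) := by
        convert key using 2
        simp only [minor]
      exact Int.isUnit_iff.mp (IsUnit.mul_iff.mp key').2
  · rw [h2] at hlen hcard hmem
    match J, hlen, hpw, hJ with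
    | [j₀, j₁], _, hpw, hJ =>
      rw [List.pairwise_cons] at hpw
      have h01 : j₀ < j₁ := hpw.1 j₁ (by simp)
      obtain ⟨e₀, he₀, hp₀⟩ := hJ j₀ (by simp)
      obtain ⟨e₁, he₁, hp₁⟩ := hJ j₁ (by simp)
      have hne : e₀ ≠ e₁ := by rintro rfl; omega
      have key := hum.isUnit_det_enum ![e₀, e₁] ![(Sum.inl (u, 0) : G₂.Gen), Sum.inl (u, 1)]
        (injective_vec2 hne) (injective_vec2 (by simp))
        (fun i => by fin_cases i <;> simp [he₀, he₁])
        (fun i => by fin_cases i <;> simp [hmem 0 (by decide), hmem 1 (by decide)]) hcard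
      rw [Matrix.det_fin_two] at key
      simp only [Matrix.of_apply, Matrix.cons_val_zero, Matrix.cons_val_one,
        tab_u_pexp hself (hru e₀ he₀), tab_u_pexp hself (hru e₁ he₁), hp₀, hp₁] at key
      have key' : IsUnit (G₂.ucoef e₀ u * G₂.ucoef e₁ u * minor (G₂.piece u) [j₀, j₁]) := by
        convert key using 2
        simp only [minor]
        ring
      exact Int.isUnit_iff.mp (IsUnit.mul_iff.mp key').2
  · rw [h3] at hlen hcard hmem
    match J, hlen, hpw, hJ with
    | [j₀, j₁, j₂], _, hpw, hJ =>
      rw [List.pairwise_cons, List.pairwise_cons] at hpw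
      have h01 : j₀ < j₁ := hpw.1 j₁ (by simp)
      have h02 : j₀ < j₂ := hpw.1 j₂ (by simp)
      have h12 : j₁ < j₂ := hpw.2.1 j₂ (by simp)
      obtain ⟨e₀, he₀, hp₀⟩ := hJ j₀ (by simp)
      obtain ⟨e₁, he₁, hp₁⟩ := hJ j₁ (by simp)
      obtain ⟨e₂, he₂, hp₂⟩ := hJ j₂ (by simp)
      have hne₁ : e₀ ≠ e₁ := by rintro rfl; omega
      have hne₂ : e₀ ≠ e₂ := by rintro rfl; omega
      have hne₃ : e₁ ≠ e₂ := by rintro rfl; omega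
      have key := hum.isUnit_det_enum ![e₀, e₁, e₂] ![(Sum.inl (u, 0) : G₂.Gen), Sum.inl (u, 1), Sum.inl (u, 2)]
        (injective_vec3 hne₁ hne₂ hne₃) (injective_vec3 (by simp) (by simp) (by simp))
        (fun i => by fin_cases i <;> simp [he₀, he₁, he₂])
        (fun i => by fin_cases i <;> simp [hmem 0 (by decide), hmem 1 (by decide), hmem 2 (by decide)]) hcard
      rw [Matrix.det_fin_three] at key
      simp only [Matrix.of_apply, Matrix.cons_val_zero, Matrix.cons_val_one, Matrix.cons_val_two, Matrix.head_cons,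
        Matrix.tail_cons, tab_u_pexp hself (hru e₀ he₀), tab_u_pexp hself (hru e₁ he₁),
        tab_u_pexp hself (hru e₂ he₂), hp₀, hp₁, hp₂] at key
      have key' : IsUnit (G₂.ucoef e₀ u * G₂.ucoef e₁ u * G₂.ucoef e₂ u * minor (G₂.piece u) [j₀, j₁, j₂]) := by
        convert key using 2
        simp only [minor]
        ring
      exact Int.isUnit_iff.mp (IsUnit.mul_iff.mp key').2

/-- **THE LOCAL STEP.**  Local unimodularity at a piece `u` on rows `ru` at `u` yields a local elimination
certificate of `piece u` on exactly the ports used by `ru` (hypotheses of the local table + the local table (★)). -/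
theorem localCert_of_um (hV : G₂.PortsValid) (hI : G₂.PortsInjective) (hself : ∀ e, (G₂.src e).1 ≠ (G₂.tgt e).1)
    {u : Fin G₂.k} {ru : Finset (Fin G₂.m)} (hru : ∀ e ∈ ru, (G₂.src e).1 = u ∨ (G₂.tgt e).1 = u)
    (hum : UM G₂.tab ru (G₂.cols {u})) : LocalCert (G₂.piece u) (G₂.uports ru u) := by
  classical
  have hcard : ru.card = (G₂.piece u).rank := by rw [hum.card_eq, cols_singleton_card₂]
  have hinj : Set.InjOn (fun e => G₂.uport e u) ru := by
    intro e₁ h₁ e₂ h₂ h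
    by_contra hne
    exact uport_ne₂ hI hne (hru e₁ h₁) (hru e₂ h₂) h
  have hlen : (G₂.uports ru u).length = (G₂.piece u).rank := by
    rw [uports, Finset.length_sort, Finset.card_image_of_injOn hinj, hcard]
  have hpw : (G₂.uports ru u).Pairwise (· < ·) := (Finset.sortedLT_sort _).pairwise
  have hlt : ∀ j ∈ G₂.uports ru u, j < (G₂.piece u).numPorts := by
    intro j hj
    obtain ⟨e, he, rfl⟩ := mem_uports.mp hj
    exact uport_lt₂ hV (hru e he)
  exact localTable (G₂.piece u)
    ⟨hlen, hpw, hlt, minor_unit_of_um hself hru hum hlen hpw fun j hj => mem_uports.mp hj⟩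

end ShadowGraph

end Summit.SmoothPoincare4.SmoothPoincare4.Theorems.RootDecompAEDoublesShadowTwoStubGradeTwoDichotomy
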